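import Literature.Analysis.FluidPDE.FluidComputer.TubeStep
import Literature.Analysis.FluidPDE.FluidComputer.ThresholdLevelCheck
import HarnessLib

/-!
# Stages 1–2 of the threshold gate under forcing: the dyadic TUBE CHECKER

HONEST FRAMING: low prior, high value-of-information experiment on Tao's machine paradigm; NOT a
claim that NS blows up.

The executable twin of `TubeStep.lean`: from an exact dyadic tube cross-section `TubeBoxD`
(integers at scale `2^P`) and a step length `h = 2^-e`, `tubeStep` COMPUTES step data (reference
curve, a-priori box by a fixed inflate-and-close iteration, defect bounds by exact coefficient
expansion, the ellipse radius by a fuelled retry, centred Grönwall envelopes with the interval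
exponential of `DyadicInterval.lean`) and CHECKS, in exact integer arithmetic, every inequality of
`TubeStep.Valid`; `tubeStep_sound` is the theorem that a successful check establishes `Valid` for
the real data it encodes (hence, by `TubeStep.tube_step`, the containment of every forced window).
`runTube` chains steps over a schedule of step exponents, recording the HULL of the a-priori boxes
of all steps on which the trigger may reach a prescribed level `CL` (the crossing read-out), and
`runTube_sound` is its soundness: the exit cross-section contains the window's end, and every point
of the window at trigger level `CL` lies in the recorded hull.  Kernel-checked runs of the design
point: `TubeTable*.lean`; the certificate: `TubeCertificate.lean`.
-/

open Set

namespace Literature.Analysis.FluidPDE.FluidComputer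

open Literature.Analysis.FluidPDE.Tao2016AveragedNS Literature.Analysis.ODE
open Literature.Analysis.ValidatedNumerics.Numerics (cdiv fdiv_le_div div_le_cdiv)

/-! ### Small interval helpers -/

namespace DI

/-- Division by `2^e` (multiplication by the step `h = 2^-e`), rounded outward. [folklore] -/
def shr (I : DI) (e : ℕ) : DI := ⟨I.lo / 2 ^ e, cdiv I.hi (2 ^ e)⟩

/-- Magnitude bound `max(|lo|, |hi|)` (scaled). [folklore] -/
def mag (I : DI) : ℤ := Max.max (Max.max I.hi (-I.lo)) 0

/-- The two-branch Grönwall envelope with an EXACT rate `k / 2^P` and step `2^-e`: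
`gronwallBound (x0/2^P) (k/2^P) E (2^-e)` for `k < 0` (interval exponential), the affine
`x0 + E·2^-e` for `k = 0`; any `k ≥ 0` is treated as `0` by the caller. [folklore] -/
def gronwallStep (P n : ℕ) (x0 k : ℤ) (E : DI) (e : ℕ) : DI :=
  if k < 0 then gronwallI P n (pt x0) (pt k) E (pt (2 ^ (P - e)))
  else (pt x0).add (E.shr e)

end DI

/-! ### Exact dyadic records -/

/-- Tube cross-section with dyadic data (integers at scale `2^P`). [folklore] -/
structure TubeBoxD where
  al : ℤ
  ah : ℤ
  bl : ℤ
  bh : ℤ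
  cl : ℤ
  ch : ℤ
  dc : ℤ
  zc : ℤ
  V : ℤ
  deriving DecidableEq, Repr

/-- [folklore] -/
noncomputable def TubeBoxD.toR (P : ℕ) (B : TubeBoxD) : TubeBox :=
  ⟨B.al / 2 ^ P, B.ah / 2 ^ P, B.bl / 2 ^ P, B.bh / 2 ^ P, B.cl / 2 ^ P, B.ch / 2 ^ P,
    B.dc / 2 ^ P, B.zc / 2 ^ P, B.V / 2 ^ P⟩

/-- Static hull box for `(a, b, d, ã)` (the trigger is pinned at the read-out level). [folklore] -/
structure HullD where
  al : ℤ
  ah : ℤ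
  bl : ℤ
  bh : ℤ
  dl : ℤ
  dh : ℤ
  zl : ℤ
  zh : ℤ
  deriving DecidableEq, Repr

namespace HullD

/-- [folklore] -/
def hull (H K : HullD) : HullD :=
  ⟨min H.al K.al, max H.ah K.ah, min H.bl K.bl, max H.bh K.bh, min H.dl K.dl, max H.dh K.dh,
    min H.zl K.zl, max H.zh K.zh⟩

/-- Real membership. [folklore] -/
def memR (P : ℕ) (H : HullD) (X : Fin 5 → ℝ) : Prop :=
  ((H.al : ℝ) / 2 ^ P ≤ X 0 ∧ X 0 ≤ (H.ah : ℝ) / 2 ^ P) ∧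
  ((H.bl : ℝ) / 2 ^ P ≤ X 1 ∧ X 1 ≤ (H.bh : ℝ) / 2 ^ P) ∧
  ((H.dl : ℝ) / 2 ^ P ≤ X 3 ∧ X 3 ≤ (H.dh : ℝ) / 2 ^ P) ∧
  ((H.zl : ℝ) / 2 ^ P ≤ X 4 ∧ X 4 ≤ (H.zh : ℝ) / 2 ^ P)

/-- Containment of integer boxes. [folklore] -/
def sub (H K : HullD) : Prop :=
  K.al ≤ H.al ∧ H.ah ≤ K.ah ∧ K.bl ≤ H.bl ∧ H.bh ≤ K.bh ∧ K.dl ≤ H.dl ∧ H.dh ≤ K.dh ∧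
    K.zl ≤ H.zl ∧ H.zh ≤ K.zh

end HullD

/-- Everything one tube step computes (integers at scale `2^P`; intervals `DI`). [folklore] -/
structure StepOut where
  /-- a-priori box and output range -/
  Al : ℤ
  Ah : ℤ
  Bl : ℤ
  Bh : ℤ
  Cl : ℤ
  Ch : ℤ
  Dl : ℤ
  Dh : ℤ
  Zl : ℤ
  Zh : ℤ
  /-- radii -/
  rd : ℤ
  rb : ℤ
  /-- reference increments: `s1 = m1·2^e`, `s2 = m2·2^{2e}`, `u1 = n1·2^e`, `u2 = n2·2^{2e}` -/
  m1 : ℤ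
  m2 : ℤ
  n1 : ℤ
  n2 : ℤ
  /-- centring rates (exact; `0` means the affine branch) -/
  ka : ℤ
  kc : ℤ
  /-- centred brackets WITHOUT the forcing, naive rate enclosures WITHOUT the forcing -/
  Ga : DI
  Gb : DI
  Gc : DI
  Fa : DI
  Fb : DI
  Fc : DI
  /-- defect bounds (forcing included) and the growth constant -/
  A : ℤ
  Bz : ℤ
  Kp : ℤ
  /-- exit cross-section -/
  B' : TubeBoxD
  deriving Repr

section Compute

variable (P n : ℕ) (GI : GateDataI) (B : TubeBoxD) (e : ℕ)

/-- Point estimate of the rotor drive `r·c·a` at the box centre (any value is sound). [folklore] -/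
def sHat : ℤ :=
  (GI.r.lo * ((B.cl + B.ch) / 2) / 2 ^ P) * ((B.al + B.ah) / 2) / 2 ^ P

/-- Reference increments: `s1 = m1·2^e`, `s2 = m2·2^{2e}`, `u1 = n1·2^e`, `u2 = n2·2^{2e}`. [folklore] -/
structure Ref4 where
  m1 : ℤ
  m2 : ℤ
  n1 : ℤ
  n2 : ℤ

/-- Reference increments: Taylor-2 coefficients of the unforced rotor pair at the centre,
pre-rounded so that the centre update is exact (any values are sound). [folklore] -/
def refCoeffs : Ref4 :=
  let s1raw := sHat P GI B - (GI.κ.lo * B.zc / 2 ^ P) * B.dc / 2 ^ P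
  let m1 := s1raw / 2 ^ e
  let s1 := m1 * 2 ^ e
  let u1raw := GI.κ.lo * (B.dc * B.dc / 2 ^ P) / 2 ^ P
  let n1 := u1raw / 2 ^ e
  let u1 := n1 * 2 ^ e
  let s2raw := -(GI.κ.lo * (B.zc * s1 / 2 ^ P + u1 * B.dc / 2 ^ P) / 2 ^ P) / 2
  let m2 := s2raw / 2 ^ (2 * e)
  let u2raw := GI.κ.lo * (B.dc * s1 / 2 ^ P) / 2 ^ P
  let n2 := u2raw / 2 ^ (2 * e)
  ⟨m1, m2, n1, n2⟩

/-- Centring rate: the natural one if clearly negative, else `0` (affine branch). [folklore] -/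
def centre (k : ℤ) : ℤ := if k < -(2 : ℤ) ^ (P - 20) then k else 0

/-- The six brackets of a step. [folklore] -/
structure Brk where
  Ga : DI
  Gb : DI
  Gc : DI
  Fa : DI
  Fb : DI
  Fc : DI

/-- The brackets on a given a-priori box `(Ia, Ib, Ic, Id)`:
`Ga ∋ F_a - ka·a`, `Gb ∋ F_b`, `Gc ∋ F_c - kc·c`, and the naive `Fa, Fb, Fc`. [folklore] -/
def brackets (Ia Ib Ic Id : DI) (ka kc : ℤ) : Brk :=
  let Ga := ((Ia.mul P (((GI.ε.mul P Ib).neg.sub (GI.σ.mul P Ic)).sub (DI.pt ka))).add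
    (GI.μ.mul P (Ic.sq P))).sub (GI.r.mul P (Id.mul P Ic))
  let Gb := (GI.ε.mul P (Ia.sq P)).sub (GI.ν.mul P (Ic.sq P))
  let Gc := (GI.σ.mul P (Ia.sq P)).add ((((GI.ν.mul P Ib).sub (GI.μ.mul P Ia)).sub (DI.pt kc)).mul P Ic)
  ⟨Ga, Gb, Gc, Ga.add ((DI.pt ka).mul P Ia), Gb, Gc.add ((DI.pt kc).mul P Ic)⟩

/-- One inflate step of the a-priori iteration for one coordinate: the hull of the entry interval
and its Euler image, widened by `2^-10` of its width and one unit. [folklore] -/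
def inflate1 (lo hi : ℤ) (F : DI) : ℤ × ℤ :=
  let dlo := GI.δ.hi
  let clo := lo + min 0 ((F.lo - dlo) / 2 ^ e)
  let chi := hi + max 0 (cdiv (F.hi + dlo) (2 ^ e))
  let w := chi - clo
  (clo - w / 1024 - 1, chi + w / 1024 + 1)

/-- An a-priori box for `(a, b, c)`. [folklore] -/
structure Box3 where
  Al : ℤ
  Ah : ℤ
  Bl : ℤ
  Bh : ℤ
  Cl : ℤ
  Ch : ℤ

/-- The a-priori box iteration for `(a, b, c)` given the conduit range `Id`: inflate steps from
the entry intervals (any result is sound; it is CHECKED). [folklore] -/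
def aprioriABC (Id : DI) (ka kc : ℤ) : ℕ → Box3
  | 0 => ⟨B.al, B.ah, B.bl, B.bh, B.cl, B.ch⟩
  | k + 1 =>
    let X := aprioriABC Id ka kc k
    let br := brackets P GI ⟨X.Al, X.Ah⟩ ⟨X.Bl, X.Bh⟩ ⟨X.Cl, X.Ch⟩ Id ka kc
    let a' := inflate1 GI e B.al B.ah br.Fa
    let b' := inflate1 GI e B.bl B.bh br.Fb
    let c' := inflate1 GI e B.cl B.ch br.Fc
    ⟨a'.1, a'.2, b'.1, b'.2, c'.1, c'.2⟩

/-- The bound `Φ` of the damped quadratic (scaled), sound in all three decidable situations.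
[folklore] -/
def phiD (Zb A rd : ℤ) : ℤ :=
  if 0 < Zb then
    let T := ((GI.κ.mul P (DI.pt Zb)).mul P (DI.pt rd)).smul 2
    let Φ1 := (((DI.pt A).sq P).div P (GI.κ.mul P (DI.pt Zb))).hi
    let Φ2 := ((((DI.pt A).mul P (DI.pt rd)).smul 4).sub
      (((GI.κ.mul P (DI.pt Zb)).mul P ((DI.pt rd).sq P)).smul 4)).hi
    if A ≤ T.lo then Φ1 else if T.hi < A then Φ2 else max Φ1 Φ2
  else ((((GI.κ.mul P (DI.pt (-Zb))).mul P ((DI.pt rd).sq P)).smul 4).add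
    (((DI.pt A).mul P (DI.pt rd)).smul 4)).hi

/-- Bound `A` of `|D_d| + δ` over a step: exact coefficient expansion of the quartic
`r a c - κ z̄ d̄ - d̄'` in `t`, each coefficient an interval, `|P(t)| ≤ Σ |p_j| h^j`. The scaled
reference data `s1 = m1 2^e, s2 = m2 2^{2e}, u1, u2` are integers at scale `2^P`. [folklore] -/
def defectA (Ia Ic : DI) (zc dc s1 s2 u1 u2 : ℤ) : ℤ :=
  let Zc := DI.pt zc
  let Dc := DI.pt dc
  let S1 := DI.pt s1
  let S2 := DI.pt s2
  let U1 := DI.pt u1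
  let U2 := DI.pt u2
  let p0 := ((GI.r.mul P (Ia.mul P Ic)).sub (GI.κ.mul P (Zc.mul P Dc))).sub S1
  let p1 := (GI.κ.mul P ((Zc.mul P S1).add (U1.mul P Dc))).neg.sub (S2.smul 2)
  let p2 := (GI.κ.mul P (((Zc.mul P S2).add (U1.mul P S1)).add (U2.mul P Dc))).neg
  let p3 := (GI.κ.mul P ((U1.mul P S2).add (U2.mul P S1))).neg
  let p4 := (GI.κ.mul P (U2.mul P S2)).neg
  p0.mag + (p1.shr (1 * e)).mag + (p2.shr (2 * e)).mag + (p3.shr (3 * e)).mag +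
    (p4.shr (4 * e)).mag + GI.δ.hi

/-- Bound `Bz` of `|D_z| + δ` over a step (the quartic `κ d̄² - z̄'`). [folklore] -/
def defectB (dc s1 s2 u1 u2 : ℤ) : ℤ :=
  let Dc := DI.pt dc
  let S1 := DI.pt s1
  let S2 := DI.pt s2
  let U1 := DI.pt u1
  let U2 := DI.pt u2
  let q0 := (GI.κ.mul P (Dc.sq P)).sub U1
  let q1 := ((GI.κ.mul P (Dc.mul P S1)).smul 2).sub (U2.smul 2)
  let q2 := GI.κ.mul P ((S1.sq P).add ((Dc.mul P S2).smul 2))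
  let q3 := (GI.κ.mul P (S1.mul P S2)).smul 2
  let q4 := GI.κ.mul P (S2.sq P)
  q0.mag + (q1.shr (1 * e)).mag + (q2.shr (2 * e)).mag + (q3.shr (3 * e)).mag +
    (q4.shr (4 * e)).mag + GI.δ.hi

/-- The free choices of a step: reference increments, radii, centring rates, a-priori box.
Any choice is sound; the step is CHECKED. [folklore] -/
structure Choice where
  m1 : ℤ
  m2 : ℤ
  n1 : ℤ
  n2 : ℤ
  rd : ℤ
  rb : ℤ
  ka : ℤ
  kc : ℤ
  X : Box3

/-- The conduit range `[Dl, Dh]`, the output base `Zb` and top `Zh` of the widened reference.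
[folklore] -/
def ranges (m1 m2 n1 n2 rd rb : ℤ) : ℤ × ℤ × ℤ × ℤ :=
  (B.dc + min 0 m1 + min 0 m2 - rd, B.dc + max 0 m1 + max 0 m2 + rd,
    B.zc + min 0 n1 + min 0 n2, B.zc + max 0 n1 + max 0 n2 + rb)

/-- The step data computed from a choice: brackets, defect bounds, growth constant, exit
cross-section. [folklore] -/
def post (q : Choice) : StepOut :=
  let s1 := q.m1 * 2 ^ e
  let s2 := q.m2 * 2 ^ (2 * e)
  let u1 := q.n1 * 2 ^ e
  let u2 := q.n2 * 2 ^ (2 * e)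
  let Dl := (ranges B q.m1 q.m2 q.n1 q.n2 q.rd q.rb).1
  let Dh := (ranges B q.m1 q.m2 q.n1 q.n2 q.rd q.rb).2.1
  let Zb := (ranges B q.m1 q.m2 q.n1 q.n2 q.rd q.rb).2.2.1
  let Zh := (ranges B q.m1 q.m2 q.n1 q.n2 q.rd q.rb).2.2.2
  let Ia : DI := ⟨q.X.Al, q.X.Ah⟩
  let Ib : DI := ⟨q.X.Bl, q.X.Bh⟩
  let Ic : DI := ⟨q.X.Cl, q.X.Ch⟩
  let Id : DI := ⟨Dl, Dh⟩
  let br := brackets P GI Ia Ib Ic Id q.ka q.kc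
  -- defect bounds
  let A := defectA P GI e Ia Ic B.zc B.dc s1 s2 u1 u2
  let Bz := defectB P GI e B.dc s1 s2 u1 u2
  let Kp := phiD P GI Zb A q.rd + (((DI.pt q.rb).mul P (DI.pt Bz)).smul 2).hi +
    (((GI.κ.mul P ((DI.pt q.rd).sq P)).mul P (DI.pt q.rb)).smul 2).hi
  -- exit cross-section
  let dh := GI.δ.hi
  let B' : TubeBoxD :=
    ⟨-(DI.gronwallStep P n (-B.al) q.ka (DI.pt (-(br.Ga.lo - dh))) e).hi,
     (DI.gronwallStep P n B.ah q.ka (DI.pt (br.Ga.hi + dh)) e).hi,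
     -(DI.gronwallStep P n (-B.bl) 0 (DI.pt (-(br.Gb.lo - dh))) e).hi,
     (DI.gronwallStep P n B.bh 0 (DI.pt (br.Gb.hi + dh)) e).hi,
     -(DI.gronwallStep P n (-B.cl) q.kc (DI.pt (-(br.Gc.lo - dh))) e).hi,
     (DI.gronwallStep P n B.ch q.kc (DI.pt (br.Gc.hi + dh)) e).hi,
     B.dc + q.m1 + q.m2, B.zc + q.n1 + q.n2, B.V + cdiv Kp (2 ^ e)⟩
  ⟨q.X.Al, q.X.Ah, q.X.Bl, q.X.Bh, q.X.Cl, q.X.Ch, Dl, Dh, Zb - q.rb, Zh, q.rd, q.rb, q.m1, q.m2,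
    q.n1, q.n2, q.ka, q.kc, br.Ga, br.Gb, br.Gc, br.Fa, br.Fb, br.Fc, A, Bz, Kp, B'⟩

/-- The checker's choice for a given ellipse radius `rb` (scaled). [folklore] -/
def choose (rb : ℤ) : Choice :=
  let R := refCoeffs P GI B e
  let rd : ℤ := (DI.sqrtHiNat ((rb * rb / 2 + 1).toNat) : ℤ)
  let rg := ranges B R.m1 R.m2 R.n1 R.n2 rd rb
  let Id : DI := ⟨rg.1, rg.2.1⟩
  let aM := (B.al + B.ah) / 2
  let bM := (B.bl + B.bh) / 2
  let cM := (B.cl + B.ch) / 2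
  let ka := centre P (-((GI.ε.lo * bM + GI.σ.lo * cM) / 2 ^ P))
  let kc := centre P ((GI.ν.lo * bM - GI.μ.lo * aM) / 2 ^ P)
  ⟨R.m1, R.m2, R.n1, R.n2, rd, rb, ka, kc, aprioriABC P GI B e Id ka kc 6⟩

/-- All the step data for a given ellipse radius `rb` (scaled). [folklore] -/
def compute (rb : ℤ) : StepOut := post P n GI B e (choose P GI B e rb)

/-- The step check: every inequality of `TubeStep.Valid` that is not automatic. [folklore] -/
abbrev okProp (o : StepOut) : Prop :=
  e ≤ P ∧ 0 ≤ o.rd ∧ 0 ≤ o.rb ∧ o.rb * o.rb ≤ 2 * (o.rd * o.rd) ∧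
  0 ≤ o.A ∧ 0 ≤ o.Bz ∧ 0 ≤ o.Kp ∧
  -- strict entry
  o.Al < B.al ∧ B.ah < o.Ah ∧ o.Bl < B.bl ∧ B.bh < o.Bh ∧ o.Cl < B.cl ∧ B.ch < o.Ch ∧
  B.V * 2 ^ P < o.rb * o.rb ∧
  -- strict Euler closure
  o.Al < B.al + (o.Fa.lo - GI.δ.hi) / 2 ^ e ∧ B.ah + cdiv (o.Fa.hi + GI.δ.hi) (2 ^ e) < o.Ah ∧
  o.Bl < B.bl + (o.Fb.lo - GI.δ.hi) / 2 ^ e ∧ B.bh + cdiv (o.Fb.hi + GI.δ.hi) (2 ^ e) < o.Bh ∧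
  o.Cl < B.cl + (o.Fc.lo - GI.δ.hi) / 2 ^ e ∧ B.ch + cdiv (o.Fc.hi + GI.δ.hi) (2 ^ e) < o.Ch ∧
  -- the ellipse closes strictly
  o.B'.V * 2 ^ P < o.rb * o.rb ∧
  -- centring rates are nonpositive; precondition of the one division used
  o.ka ≤ 0 ∧ o.kc ≤ 0 ∧ (0 < (GI.κ.mul P (DI.pt (o.Zl + o.rb))).lo ∨ ¬0 < o.Zl + o.rb)

/-- The decidable step check. [folklore] -/
def okB (o : StepOut) : Bool := decide (okProp P GI B e o)

/-- The ellipse retry: try a radius, and if the ellipse does not close, enlarge it from the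
computed growth (fuel `k`). [folklore] -/
def tryEllipse : ℕ → ℤ → Option StepOut
  | 0, _ => none
  | k + 1, rb =>
    let o := compute P n GI B e rb
    if okB P GI B e o then some o
    else
      let V1 := max (o.B'.V) (B.V + 1)
      let rb' := (DI.sqrtHiNat ((V1 * 2 ^ P).toNat) : ℤ)
      tryEllipse k (rb' + rb' / 512 + 1)

/-- **The tube step**: the checked step data, if the step closes. [folklore] -/
def tubeStep : Option StepOut :=
  let rb0 := (DI.sqrtHiNat ((B.V * 2 ^ P).toNat) : ℤ)
  tryEllipse P n GI B e 4 (rb0 + rb0 / 1024 + 1)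

end Compute

/-! ### The run over a schedule, with the crossing read-out -/

/-- Run state: current cross-section, whether a hull has been started, the hull. [folklore] -/
structure TubeState where
  B : TubeBoxD
  flag : Bool
  H : HullD
  deriving DecidableEq, Repr

/-- The static hull box of a step's a-priori data. [folklore] -/
def StepOut.box5 (o : StepOut) : HullD := ⟨o.Al, o.Ah, o.Bl, o.Bh, o.Dl, o.Dh, o.Zl, o.Zh⟩

/-- The state after a successful step: new cross-section; the hull absorbs the step's a-priori box
whenever the trigger may reach the read-out level `CL` on it. [folklore] -/
def TubeState.next (CL : ℤ) (st : TubeState) (o : StepOut) : TubeState :=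
  if CL ≤ o.Ch then ⟨o.B', true, if st.flag then st.H.hull o.box5 else o.box5⟩
  else ⟨o.B', st.flag, st.H⟩

/-- The a-priori data of a step lie in the cube `[-R, R]⁵` (mode-ball bookkeeping). [folklore] -/
abbrev StepOut.inBall (R : ℤ) (o : StepOut) : Prop :=
  -R ≤ o.Al ∧ o.Ah ≤ R ∧ -R ≤ o.Bl ∧ o.Bh ≤ R ∧ -R ≤ o.Cl ∧ o.Ch ≤ R ∧ -R ≤ o.Dl ∧ o.Dh ≤ R ∧
    -R ≤ o.Zl ∧ o.Zh ≤ R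

/-- **The run**: tube steps over a schedule of step exponents `e` (`h = 2^-e`), each step checked
and confined to the cube `[-R, R]⁵`. [folklore] -/
def runTube (P n : ℕ) (GI : GateDataI) (CL R : ℤ) : TubeState → List ℕ → Option TubeState
  | st, [] => some st
  | st, e :: rest =>
    match tubeStep P n GI st.B e with
    | none => none
    | some o => if o.inBall R then runTube P n GI CL R (st.next CL o) rest else none

/-- Duration of a schedule of step exponents. [folklore] -/
noncomputable def dur : List ℕ → ℝ
  | [] => 0
  | e :: rest => 1 / 2 ^ e + dur rest

/-- [folklore] -/
theorem dur_nonneg : ∀ l : List ℕ, 0 ≤ dur l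
  | [] => le_rfl
  | e :: rest => by unfold dur; have := dur_nonneg rest; positivity

/-- [folklore] -/
theorem runTube_append (P n : ℕ) (GI : GateDataI) (CL R : ℤ) :
    ∀ (xs ys : List ℕ) (st : TubeState), runTube P n GI CL R st (xs ++ ys) =
      (runTube P n GI CL R st xs).bind fun st' => runTube P n GI CL R st' ys
  | [], ys, st => by simp [runTube]
  | e :: xs, ys, st => by
    simp only [List.cons_append, runTube]
    cases tubeStep P n GI st.B e with
    | none => rfl
    | some o =>
      simp only
      split_ifs
      · exact runTube_append P n GI CL R xs ys _
      · rfl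

/-- [folklore] -/
theorem runTube_append_some {P n : ℕ} {GI : GateDataI} {CL R : ℤ} {xs ys : List ℕ}
    {st st₁ st₂ : TubeState} (h₁ : runTube P n GI CL R st xs = some st₁)
    (h₂ : runTube P n GI CL R st₁ ys = some st₂) : runTube P n GI CL R st (xs ++ ys) = some st₂ := by
  rw [runTube_append, h₁, Option.bind_some, h₂]

/-- [folklore] -/
theorem dur_append : ∀ xs ys : List ℕ, dur (xs ++ ys) = dur xs + dur ys
  | [], ys => by simp [dur]
  | e :: xs, ys => by simp only [List.cons_append, dur, dur_append xs ys]; ring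

/-- [folklore] -/
theorem dur_replicate (k e : ℕ) : dur (List.replicate k e) = k * (1 / 2 ^ e) := by
  induction k with
  | zero => simp [dur]
  | succ k ih => simp only [List.replicate_succ, dur, ih]; push_cast; ring

/-! ### Soundness, part 1: interval helpers -/

namespace DI

variable {P : ℕ}

/-- [folklore] -/
theorem lo_div_le_of_mem {I : DI} {x : ℝ} (h : I.mem P x) : (I.lo : ℝ) / 2 ^ P ≤ x := by
  rw [div_le_iff₀ (pow_pos two_pos P)]; exact h.1

/-- [folklore] -/
theorem le_hi_div_of_mem {I : DI} {x : ℝ} (h : I.mem P x) : x ≤ (I.hi : ℝ) / 2 ^ P := by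
  rw [le_div_iff₀ (pow_pos two_pos P)]; exact h.2

/-- [folklore] -/
theorem mem_mk {lo hi : ℤ} {x : ℝ} (h1 : (lo : ℝ) / 2 ^ P ≤ x) (h2 : x ≤ (hi : ℝ) / 2 ^ P) :
    (⟨lo, hi⟩ : DI).mem P x :=
  ⟨(div_le_iff₀ (pow_pos two_pos P)).1 h1, (le_div_iff₀ (pow_pos two_pos P)).1 h2⟩

/-- [folklore] -/
theorem mem_shr {I : DI} {x : ℝ} (h : I.mem P x) (e : ℕ) : (I.shr e).mem P (x / 2 ^ e) := by
  have h2 : (0 : ℝ) < 2 ^ e := pow_pos two_pos e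
  have h2Z : (0 : ℤ) < 2 ^ e := by positivity
  have hf := fdiv_le_div (a := I.lo) h2Z
  have hc := div_le_cdiv (a := I.hi) h2Z
  push_cast at hf hc
  have e1 : x / 2 ^ e * 2 ^ P = (x * 2 ^ P) / 2 ^ e := by ring
  refine ⟨?_, ?_⟩
  · show ((I.lo / 2 ^ e : ℤ) : ℝ) ≤ x / 2 ^ e * 2 ^ P
    rw [e1]; exact hf.trans (div_le_div_of_nonneg_right h.1 h2.le)
  · show x / 2 ^ e * 2 ^ P ≤ ((cdiv I.hi (2 ^ e) : ℤ) : ℝ)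
    rw [e1]; exact (div_le_div_of_nonneg_right h.2 h2.le).trans hc

/-- [folklore] -/
theorem mag_nonneg (I : DI) : 0 ≤ I.mag := le_max_right _ _

/-- [folklore] -/
theorem abs_le_mag {I : DI} {x : ℝ} (h : I.mem P x) : |x| ≤ (I.mag : ℝ) / 2 ^ P := by
  rw [le_div_iff₀ (pow_pos two_pos P)]
  obtain ⟨h1, h2⟩ := h
  simp only [mag, Int.cast_max, Int.cast_neg, Int.cast_zero]
  rcases le_or_gt 0 x with hx | hx
  · rw [abs_of_nonneg hx]; exact h2.trans ((le_max_left _ _).trans (le_max_left _ _))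
  · rw [abs_of_neg hx]
    have : -x * 2 ^ P ≤ -(I.lo : ℝ) := by linarith
    exact this.trans ((le_max_right _ _).trans (le_max_left _ _))

/-- `2^(P-e) / 2^P = 2^-e` for `e ≤ P`. [folklore] -/
theorem mem_pt_step {e : ℕ} (he : e ≤ P) : (pt (2 ^ (P - e))).mem P ((1 : ℝ) / 2 ^ e) := by
  have h := mem_pt P (2 ^ (P - e))
  have hq : (((2 : ℤ) ^ (P - e) : ℤ) : ℝ) / 2 ^ P = 1 / 2 ^ e := by
    rw [div_eq_div_iff (pow_pos two_pos P).ne' (pow_pos two_pos e).ne', one_mul, Int.cast_pow,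
      Int.cast_ofNat, ← pow_add, Nat.sub_add_cancel he]
  rwa [hq] at h

/-- [folklore] -/
theorem mul_pt_hi_nonpos {k m : ℤ} (hk : k < 0) (hm : 0 ≤ m) : ((pt k).mul P (pt m)).hi ≤ 0 := by
  have hkm : k * m ≤ 0 := Int.mul_nonpos_of_nonpos_of_nonneg hk.le hm
  simp only [mul, pt, max4, max_self, cdiv]
  have : 0 ≤ -(k * m) / 2 ^ P := Int.ediv_nonneg (by linarith) (by positivity)
  linarith

/-- Soundness of the two-branch Grönwall envelope. [folklore] -/
theorem gronwallStep_sound {n : ℕ} (hn : 0 < n) {x0 k : ℤ} {EI : DI} {E : ℝ} (hE : EI.mem P E)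
    (hk : k ≤ 0) {e : ℕ} (he : e ≤ P) :
    gronwallBound ((x0 : ℝ) / 2 ^ P) ((k : ℝ) / 2 ^ P) E (1 / 2 ^ e) ≤
      ((gronwallStep P n x0 k EI e).hi : ℝ) / 2 ^ P := by
  unfold gronwallStep
  split_ifs with hk0
  · apply le_hi_div_of_mem
    refine mem_gronwallI hn (by simpa [pt] using hk0) ?_ (mem_pt P x0) (mem_pt P k) hE
      (mem_pt_step he)
    exact mul_pt_hi_nonpos hk0 (by positivity)
  · have hk' : k = 0 := le_antisymm hk (not_lt.1 hk0)
    subst hk'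
    simp only [Int.cast_zero, zero_div, gronwallBound_K0]
    have h := le_hi_div_of_mem (mem_add (mem_pt P x0) (mem_shr hE e))
    have : E * (1 / 2 ^ e) = E / 2 ^ e := by ring
    rw [this]; exact h

/-- Lower version: `-gronwallBound (-x0) k (-E) h ≥ -(…).hi`. [folklore] -/
theorem gronwallStep_sound_lo {n : ℕ} (hn : 0 < n) {x0 k : ℤ} {EI : DI} {E : ℝ}
    (hE : EI.mem P (-E)) (hk : k ≤ 0) {e : ℕ} (he : e ≤ P) :
    ((-(gronwallStep P n (-x0) k EI e).hi : ℤ) : ℝ) / 2 ^ P ≤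
      -gronwallBound (-((x0 : ℝ) / 2 ^ P)) ((k : ℝ) / 2 ^ P) (-E) (1 / 2 ^ e) := by
  have h := gronwallStep_sound hn (x0 := -x0) hE hk he
  push_cast at h ⊢
  rw [neg_div] at h
  rw [neg_div]; linarith

end DI

/-- A monomial `c·t^j` on `[0, h]` lies between `min 0 (c h^j)` and `max 0 (c h^j)`. [folklore] -/
theorem monomial_range {c t h : ℝ} (j : ℕ) (ht0 : 0 ≤ t) (hth : t ≤ h) :
    min 0 (c * h ^ j) ≤ c * t ^ j ∧ c * t ^ j ≤ max 0 (c * h ^ j) := by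
  have hp : t ^ j ≤ h ^ j := pow_le_pow_left₀ ht0 hth j
  have hp0 : 0 ≤ t ^ j := pow_nonneg ht0 j
  rcases le_or_gt 0 c with hc | hc
  · exact ⟨(min_le_left _ _).trans (mul_nonneg hc hp0),
      (mul_le_mul_of_nonneg_left hp hc).trans (le_max_right _ _)⟩
  · refine ⟨(min_le_right _ _).trans ?_, (le_max_left _ _).trans' ?_⟩
    · exact mul_le_mul_of_nonpos_left hp hc.le
    · exact mul_nonpos_of_nonpos_of_nonneg hc.le hp0

/-! ### Soundness, part 2: enclosures of one step -/

section StepSound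

variable {P n : ℕ} {GI : GateDataI} {G : GateData}

/-- The brackets enclose the (centred) rates on the box. [folklore] -/
theorem brackets_mem (hGI : GI.Mem P G) (Ia Ib Ic Id : DI) (ka kc : ℤ) {X : Fin 5 → ℝ}
    (ha : Ia.mem P (X 0)) (hb : Ib.mem P (X 1)) (hc : Ic.mem P (X 2)) (hd : Id.mem P (X 3)) :
    (brackets P GI Ia Ib Ic Id ka kc).Ga.mem P
        (thresholdCircuit G.ε G.σ G.ν G.μ G.r G.κ X 0 - (ka : ℝ) / 2 ^ P * X 0) ∧
      (brackets P GI Ia Ib Ic Id ka kc).Gb.mem P (thresholdCircuit G.ε G.σ G.ν G.μ G.r G.κ X 1) ∧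
      (brackets P GI Ia Ib Ic Id ka kc).Gc.mem P
        (thresholdCircuit G.ε G.σ G.ν G.μ G.r G.κ X 2 - (kc : ℝ) / 2 ^ P * X 2) ∧
      (brackets P GI Ia Ib Ic Id ka kc).Fa.mem P (thresholdCircuit G.ε G.σ G.ν G.μ G.r G.κ X 0) ∧
      (brackets P GI Ia Ib Ic Id ka kc).Fb.mem P (thresholdCircuit G.ε G.σ G.ν G.μ G.r G.κ X 1) ∧
      (brackets P GI Ia Ib Ic Id ka kc).Fc.mem P (thresholdCircuit G.ε G.σ G.ν G.μ G.r G.κ X 2) := by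
  have hka := DI.mem_pt P ka
  have hkc := DI.mem_pt P kc
  have hGa : (brackets P GI Ia Ib Ic Id ka kc).Ga.mem P
      (thresholdCircuit G.ε G.σ G.ν G.μ G.r G.κ X 0 - (ka : ℝ) / 2 ^ P * X 0) := by
    have h := DI.mem_sub (DI.mem_add (DI.mem_mul ha (DI.mem_sub (DI.mem_sub
      (DI.mem_neg (DI.mem_mul hGI.ε hb)) (DI.mem_mul hGI.σ hc)) hka))
      (DI.mem_mul hGI.μ (DI.mem_sq hc))) (DI.mem_mul hGI.r (DI.mem_mul hd hc))
    have e1 : thresholdCircuit G.ε G.σ G.ν G.μ G.r G.κ X 0 - (ka : ℝ) / 2 ^ P * X 0 =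
        X 0 * (-(G.ε * X 1) - G.σ * X 2 - (ka : ℝ) / 2 ^ P) + G.μ * X 2 ^ 2 - G.r * (X 3 * X 2) := by
      simp only [thresholdCircuit_apply_zero]; ring
    rw [e1]; exact h
  have hGb : (brackets P GI Ia Ib Ic Id ka kc).Gb.mem P
      (thresholdCircuit G.ε G.σ G.ν G.μ G.r G.κ X 1) := by
    have h := DI.mem_sub (DI.mem_mul hGI.ε (DI.mem_sq ha)) (DI.mem_mul hGI.ν (DI.mem_sq hc))
    have e1 : thresholdCircuit G.ε G.σ G.ν G.μ G.r G.κ X 1 = G.ε * X 0 ^ 2 - G.ν * X 2 ^ 2 := by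
      simp only [thresholdCircuit_apply_one]
    rw [e1]; exact h
  have hGc : (brackets P GI Ia Ib Ic Id ka kc).Gc.mem P
      (thresholdCircuit G.ε G.σ G.ν G.μ G.r G.κ X 2 - (kc : ℝ) / 2 ^ P * X 2) := by
    have h := DI.mem_add (DI.mem_mul hGI.σ (DI.mem_sq ha)) (DI.mem_mul (DI.mem_sub (DI.mem_sub
      (DI.mem_mul hGI.ν hb) (DI.mem_mul hGI.μ ha)) hkc) hc)
    have e1 : thresholdCircuit G.ε G.σ G.ν G.μ G.r G.κ X 2 - (kc : ℝ) / 2 ^ P * X 2 =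
        G.σ * X 0 ^ 2 + (G.ν * X 1 - G.μ * X 0 - (kc : ℝ) / 2 ^ P) * X 2 := by
      simp only [thresholdCircuit_apply_two]; ring
    rw [e1]; exact h
  refine ⟨hGa, hGb, hGc, ?_, hGb, ?_⟩
  · have h := DI.mem_add hGa (DI.mem_mul hka ha)
    have e1 : thresholdCircuit G.ε G.σ G.ν G.μ G.r G.κ X 0 =
        thresholdCircuit G.ε G.σ G.ν G.μ G.r G.κ X 0 - (ka : ℝ) / 2 ^ P * X 0 +
          (ka : ℝ) / 2 ^ P * X 0 := by ring
    rw [e1]; exact h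
  · have h := DI.mem_add hGc (DI.mem_mul hkc hc)
    have e1 : thresholdCircuit G.ε G.σ G.ν G.μ G.r G.κ X 2 =
        thresholdCircuit G.ε G.σ G.ν G.μ G.r G.κ X 2 - (kc : ℝ) / 2 ^ P * X 2 +
          (kc : ℝ) / 2 ^ P * X 2 := by ring
    rw [e1]; exact h

/-- Range of the linear reference term on a step. [folklore] -/
theorem range_lin (m : ℤ) (e : ℕ) {t : ℝ} (ht0 : 0 ≤ t) (hth : t ≤ 1 / 2 ^ e) :
    ((min 0 m : ℤ) : ℝ) / 2 ^ P ≤ ((m * 2 ^ e : ℤ) : ℝ) / 2 ^ P * t ∧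
      ((m * 2 ^ e : ℤ) : ℝ) / 2 ^ P * t ≤ ((max 0 m : ℤ) : ℝ) / 2 ^ P := by
  have h2P : (0 : ℝ) < 2 ^ P := pow_pos two_pos P
  have h2e : (0 : ℝ) < 2 ^ e := pow_pos two_pos e
  have key : ((m * 2 ^ e : ℤ) : ℝ) / 2 ^ P * (1 / 2 ^ e) = (m : ℝ) / 2 ^ P := by
    push_cast; field_simp
  rcases le_or_gt 0 m with hm | hm
  · have hs : 0 ≤ ((m * 2 ^ e : ℤ) : ℝ) / 2 ^ P := by positivity
    rw [min_eq_left hm, max_eq_right hm, Int.cast_zero, zero_div]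
    refine ⟨mul_nonneg hs ht0, ?_⟩
    rw [← key]; exact mul_le_mul_of_nonneg_left hth hs
  · have hs : ((m * 2 ^ e : ℤ) : ℝ) / 2 ^ P ≤ 0 := by
      apply div_nonpos_of_nonpos_of_nonneg _ h2P.le
      exact_mod_cast (mul_nonpos_of_nonpos_of_nonneg hm.le (by positivity) : m * 2 ^ e ≤ 0)
    rw [min_eq_right hm.le, max_eq_left hm.le, Int.cast_zero, zero_div]
    refine ⟨?_, mul_nonpos_of_nonpos_of_nonneg hs ht0⟩
    rw [← key]; exact mul_le_mul_of_nonpos_left hth hs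

/-- Range of the quadratic reference term on a step. [folklore] -/
theorem range_sq (m : ℤ) (e : ℕ) {t : ℝ} (ht0 : 0 ≤ t) (hth : t ≤ 1 / 2 ^ e) :
    ((min 0 m : ℤ) : ℝ) / 2 ^ P ≤ ((m * 2 ^ (2 * e) : ℤ) : ℝ) / 2 ^ P * t ^ 2 ∧
      ((m * 2 ^ (2 * e) : ℤ) : ℝ) / 2 ^ P * t ^ 2 ≤ ((max 0 m : ℤ) : ℝ) / 2 ^ P := by
  have h2P : (0 : ℝ) < 2 ^ P := pow_pos two_pos P
  have h2e : (0 : ℝ) < 2 ^ e := pow_pos two_pos e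
  have hp : t ^ 2 ≤ (1 / 2 ^ e) ^ 2 := pow_le_pow_left₀ ht0 hth 2
  have hp0 : 0 ≤ t ^ 2 := sq_nonneg t
  have h22 : ((2 : ℝ)) ^ (2 * e) = (2 ^ e) ^ 2 := by rw [mul_comm, pow_mul]
  have key : ((m * 2 ^ (2 * e) : ℤ) : ℝ) / 2 ^ P * (1 / 2 ^ e) ^ 2 = (m : ℝ) / 2 ^ P := by
    push_cast; rw [h22]; field_simp
  rcases le_or_gt 0 m with hm | hm
  · have hs : 0 ≤ ((m * 2 ^ (2 * e) : ℤ) : ℝ) / 2 ^ P := by positivity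
    rw [min_eq_left hm, max_eq_right hm, Int.cast_zero, zero_div]
    refine ⟨mul_nonneg hs hp0, ?_⟩
    rw [← key]; exact mul_le_mul_of_nonneg_left hp hs
  · have hs : ((m * 2 ^ (2 * e) : ℤ) : ℝ) / 2 ^ P ≤ 0 := by
      apply div_nonpos_of_nonpos_of_nonneg _ h2P.le
      exact_mod_cast (mul_nonpos_of_nonpos_of_nonneg hm.le (by positivity) : m * 2 ^ (2 * e) ≤ 0)
    rw [min_eq_right hm.le, max_eq_left hm.le, Int.cast_zero, zero_div]
    refine ⟨?_, mul_nonpos_of_nonpos_of_nonneg hs hp0⟩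
    rw [← key]; exact mul_le_mul_of_nonpos_left hp hs

/-- Floor step: `⌊a/2^e⌋/2^P ≤ 2^-e · a/2^P`. [folklore] -/
theorem floor_step_le (a : ℤ) (e : ℕ) :
    ((a / 2 ^ e : ℤ) : ℝ) / 2 ^ P ≤ 1 / 2 ^ e * ((a : ℝ) / 2 ^ P) := by
  have h2Z : (0 : ℤ) < 2 ^ e := by positivity
  have hf := fdiv_le_div (a := a) h2Z
  push_cast at hf
  have : 1 / 2 ^ e * ((a : ℝ) / 2 ^ P) = (a : ℝ) / 2 ^ e / 2 ^ P := by ring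
  rw [this]; exact div_le_div_of_nonneg_right hf (pow_pos two_pos P).le

/-- Ceiling step: `2^-e · a/2^P ≤ ⌈a/2^e⌉/2^P`. [folklore] -/
theorem le_ceil_step (a : ℤ) (e : ℕ) :
    1 / 2 ^ e * ((a : ℝ) / 2 ^ P) ≤ ((cdiv a (2 ^ e) : ℤ) : ℝ) / 2 ^ P := by
  have h2Z : (0 : ℤ) < 2 ^ e := by positivity
  have hc := div_le_cdiv (a := a) h2Z
  push_cast at hc
  have : 1 / 2 ^ e * ((a : ℝ) / 2 ^ P) = (a : ℝ) / 2 ^ e / 2 ^ P := by ring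
  rw [this]; exact div_le_div_of_nonneg_right hc (pow_pos two_pos P).le

/-- Lower bracket with the forcing folded in. [folklore] -/
theorem lo_forced {I : DI} {v : ℝ} (hI : I.mem P v) (hδ : GI.δ.mem P G.δ) :
    ((I.lo - GI.δ.hi : ℤ) : ℝ) / 2 ^ P + G.δ ≤ v := by
  have h1 := DI.lo_div_le_of_mem hI
  have h2 := DI.le_hi_div_of_mem hδ
  push_cast [sub_div] at *; linarith

/-- Upper bracket with the forcing folded in. [folklore] -/
theorem hi_forced {I : DI} {v : ℝ} (hI : I.mem P v) (hδ : GI.δ.mem P G.δ) :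
    v ≤ ((I.hi + GI.δ.hi : ℤ) : ℝ) / 2 ^ P - G.δ := by
  have h1 := DI.le_hi_div_of_mem hI
  have h2 := DI.le_hi_div_of_mem hδ
  push_cast [add_div] at *; linarith

/-- Triangle bound of a quartic on `[0, h]`. [folklore] -/
theorem poly4_bound {p0 p1 p2 p3 p4 t h M0 M1 M2 M3 M4 : ℝ} (ht0 : 0 ≤ t) (hth : t ≤ h)
    (h0 : |p0| ≤ M0) (h1 : |p1| * h ^ 1 ≤ M1) (h2 : |p2| * h ^ 2 ≤ M2) (h3 : |p3| * h ^ 3 ≤ M3)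
    (h4 : |p4| * h ^ 4 ≤ M4) :
    |p0 + p1 * t + p2 * t ^ 2 + p3 * t ^ 3 + p4 * t ^ 4| ≤ M0 + M1 + M2 + M3 + M4 := by
  have hp : ∀ j : ℕ, t ^ j ≤ h ^ j := fun j => pow_le_pow_left₀ ht0 hth j
  have e1 : |p1 * t| ≤ M1 := by
    rw [pow_one] at h1
    rw [abs_mul, abs_of_nonneg ht0]; exact (mul_le_mul_of_nonneg_left hth (abs_nonneg _)).trans h1
  have e2 : |p2 * t ^ 2| ≤ M2 := by
    rw [abs_mul, abs_of_nonneg (pow_nonneg ht0 2)]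
    exact (mul_le_mul_of_nonneg_left (hp 2) (abs_nonneg _)).trans h2
  have e3 : |p3 * t ^ 3| ≤ M3 := by
    rw [abs_mul, abs_of_nonneg (pow_nonneg ht0 3)]
    exact (mul_le_mul_of_nonneg_left (hp 3) (abs_nonneg _)).trans h3
  have e4 : |p4 * t ^ 4| ≤ M4 := by
    rw [abs_mul, abs_of_nonneg (pow_nonneg ht0 4)]
    exact (mul_le_mul_of_nonneg_left (hp 4) (abs_nonneg _)).trans h4
  calc |p0 + p1 * t + p2 * t ^ 2 + p3 * t ^ 3 + p4 * t ^ 4|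
      ≤ |p0 + p1 * t + p2 * t ^ 2 + p3 * t ^ 3| + |p4 * t ^ 4| := abs_add_le _ _
    _ ≤ |p0 + p1 * t + p2 * t ^ 2| + |p3 * t ^ 3| + |p4 * t ^ 4| := by
        gcongr; exact abs_add_le _ _
    _ ≤ |p0 + p1 * t| + |p2 * t ^ 2| + |p3 * t ^ 3| + |p4 * t ^ 4| := by
        gcongr; exact abs_add_le _ _
    _ ≤ |p0| + |p1 * t| + |p2 * t ^ 2| + |p3 * t ^ 3| + |p4 * t ^ 4| := by
        gcongr; exact abs_add_le _ _
    _ ≤ M0 + M1 + M2 + M3 + M4 := by gcongr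

/-- A coefficient enclosure gives the bound of the scaled monomial. [folklore] -/
theorem coeff_bound {pI : DI} {p : ℝ} (hp : pI.mem P p) (j e : ℕ) :
    |p| * (1 / 2 ^ e) ^ j ≤ ((pI.shr (j * e)).mag : ℝ) / 2 ^ P := by
  have h := DI.abs_le_mag (DI.mem_shr hp (j * e))
  have e1 : |p| * (1 / 2 ^ e) ^ j = |p / 2 ^ (j * e)| := by
    rw [abs_div, abs_of_pos (by positivity : (0 : ℝ) < 2 ^ (j * e)), one_div_pow, ← pow_mul,
      mul_comm e j]; ring
  rw [e1]; exact h

/-- Soundness of `phiD`. [folklore] -/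
theorem phiD_sound (hGI : GI.Mem P G) (_hG : G.Valid) {Zb A rd : ℤ}
    (hdiv : 0 < (GI.κ.mul P (DI.pt Zb)).lo ∨ ¬0 < Zb) :
    TubeStep.phiBound G.κ ((Zb : ℝ) / 2 ^ P) ((A : ℝ) / 2 ^ P) ((rd : ℝ) / 2 ^ P) ≤
      ((phiD P GI Zb A rd : ℤ) : ℝ) / 2 ^ P := by
  have h2P : (0 : ℝ) < 2 ^ P := pow_pos two_pos P
  have hZm := DI.mem_pt P Zb
  have hAm := DI.mem_pt P A
  have hrm := DI.mem_pt P rd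
  have hκ := hGI.κ
  unfold phiD TubeStep.phiBound
  by_cases hZ : 0 < Zb
  · have hZ' : (0 : ℝ) < (Zb : ℝ) / 2 ^ P := by positivity
    rw [if_pos hZ', if_pos hZ]
    have hT := DI.mem_smul 2 (DI.mem_mul (DI.mem_mul hκ hZm) hrm)
    have hΦ2 := DI.le_hi_div_of_mem (DI.mem_sub (DI.mem_smul 4 (DI.mem_mul hAm hrm))
      (DI.mem_smul 4 (DI.mem_mul (DI.mem_mul hκ hZm) (DI.mem_sq hrm))))
    have hΦ1 : (A : ℝ) / 2 ^ P ≤ 2 * G.κ * ((Zb : ℝ) / 2 ^ P) * ((rd : ℝ) / 2 ^ P) →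
        ((A : ℝ) / 2 ^ P) ^ 2 / (G.κ * ((Zb : ℝ) / 2 ^ P)) ≤
        (((((DI.pt A).sq P).div P (GI.κ.mul P (DI.pt Zb))).hi : ℤ) : ℝ) / 2 ^ P := fun _ =>
      DI.le_hi_div_of_mem (DI.mem_div (hdiv.resolve_right (not_not.2 hZ)) (DI.mem_sq hAm)
        (DI.mem_mul hκ hZm))
    have e4 : ((4 : ℕ) : ℝ) = 4 := by norm_num
    have e2 : ((2 : ℕ) : ℝ) = 2 := by norm_num
    rw [e4] at hΦ2; rw [e2] at hT
    have hΦ2' : 4 * ((A : ℝ) / 2 ^ P) * ((rd : ℝ) / 2 ^ P) -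
        4 * G.κ * ((Zb : ℝ) / 2 ^ P) * ((rd : ℝ) / 2 ^ P) ^ 2 ≤
        (((((DI.pt A).mul P (DI.pt rd)).smul 4).sub
          (((GI.κ.mul P (DI.pt Zb)).mul P ((DI.pt rd).sq P)).smul 4)).hi : ℝ) / 2 ^ P := by
      refine le_trans (le_of_eq ?_) hΦ2; ring
    dsimp only
    by_cases hr : (A : ℝ) / 2 ^ P ≤ 2 * G.κ * ((Zb : ℝ) / 2 ^ P) * ((rd : ℝ) / 2 ^ P)
    · rw [if_pos hr]
      by_cases c1 : A ≤ (((GI.κ.mul P (DI.pt Zb)).mul P (DI.pt rd)).smul 2).lo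
      · rw [if_pos c1]; exact hΦ1 hr
      · rw [if_neg c1]
        by_cases c2 : (((GI.κ.mul P (DI.pt Zb)).mul P (DI.pt rd)).smul 2).hi < A
        · exfalso
          have h1 := DI.le_hi_div_of_mem hT
          have hc : _ < (A : ℝ) / 2 ^ P := div_lt_div_of_pos_right (Int.cast_lt.2 c2) h2P
          linarith
        · rw [if_neg c2]
          exact (hΦ1 hr).trans
            (div_le_div_of_nonneg_right (by exact_mod_cast le_max_left _ _) h2P.le)
    · rw [if_neg hr]
      by_cases c1 : A ≤ (((GI.κ.mul P (DI.pt Zb)).mul P (DI.pt rd)).smul 2).lo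
      · exfalso; apply hr
        have h1 := DI.lo_div_le_of_mem hT
        have hc : (A : ℝ) / 2 ^ P ≤ _ := div_le_div_of_nonneg_right (Int.cast_le.2 c1) h2P.le
        linarith
      · rw [if_neg c1]
        by_cases c2 : (((GI.κ.mul P (DI.pt Zb)).mul P (DI.pt rd)).smul 2).hi < A
        · rw [if_pos c2]; exact hΦ2'
        · rw [if_neg c2]
          exact hΦ2'.trans
            (div_le_div_of_nonneg_right (by exact_mod_cast le_max_right _ _) h2P.le)
  · have hZ' : ¬(0 : ℝ) < (Zb : ℝ) / 2 ^ P := by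
      intro h; apply hZ; have := (div_pos_iff_of_pos_right h2P).1 h; exact_mod_cast this
    rw [if_neg hZ', if_neg hZ]
    have hnZ : (DI.pt (-Zb)).mem P (-((Zb : ℝ) / 2 ^ P)) := by
      have := DI.mem_pt P (-Zb); push_cast [neg_div] at this ⊢; exact this
    have h := DI.le_hi_div_of_mem (DI.mem_add
      (DI.mem_smul 4 (DI.mem_mul (DI.mem_mul hκ hnZ) (DI.mem_sq hrm)))
      (DI.mem_smul 4 (DI.mem_mul hAm hrm)))
    have e4 : ((4 : ℕ) : ℝ) = 4 := by norm_num
    rw [e4] at h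
    refine le_trans (le_of_eq ?_) h; ring

/-- Soundness of `defectA`. [folklore] -/
theorem defectA_sound (hGI : GI.Mem P G) {Ia Ic : DI} {X0 X2 : ℝ} (m0 : Ia.mem P X0)
    (m2 : Ic.mem P X2) (zc dc s1 s2 u1 u2 : ℤ) (e : ℕ) {t : ℝ} (ht : t ∈ Icc 0 ((1 : ℝ) / 2 ^ e)) :
    |G.r * X0 * X2 -
        G.κ * ((zc : ℝ) / 2 ^ P + (u1 : ℝ) / 2 ^ P * t + (u2 : ℝ) / 2 ^ P * t ^ 2) *
          ((dc : ℝ) / 2 ^ P + (s1 : ℝ) / 2 ^ P * t + (s2 : ℝ) / 2 ^ P * t ^ 2) -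
        ((s1 : ℝ) / 2 ^ P + 2 * ((s2 : ℝ) / 2 ^ P) * t)| + G.δ ≤
      ((defectA P GI e Ia Ic zc dc s1 s2 u1 u2 : ℤ) : ℝ) / 2 ^ P := by
  have hzc := DI.mem_pt P zc
  have hdc := DI.mem_pt P dc
  have hs1 := DI.mem_pt P s1
  have hs2 := DI.mem_pt P s2
  have hu1 := DI.mem_pt P u1
  have hu2 := DI.mem_pt P u2
  have hκ := hGI.κ
  have e2 : ((2 : ℕ) : ℝ) = 2 := by norm_num
  have hp0 := DI.mem_sub (DI.mem_sub (DI.mem_mul hGI.r (DI.mem_mul m0 m2))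
    (DI.mem_mul hκ (DI.mem_mul hzc hdc))) hs1
  have hp1 := DI.mem_sub (DI.mem_neg (DI.mem_mul hκ (DI.mem_add (DI.mem_mul hzc hs1)
    (DI.mem_mul hu1 hdc)))) (DI.mem_smul 2 hs2)
  have hp2 := DI.mem_neg (DI.mem_mul hκ (DI.mem_add (DI.mem_add (DI.mem_mul hzc hs2)
    (DI.mem_mul hu1 hs1)) (DI.mem_mul hu2 hdc)))
  have hp3 := DI.mem_neg (DI.mem_mul hκ (DI.mem_add (DI.mem_mul hu1 hs2) (DI.mem_mul hu2 hs1)))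
  have hp4 := DI.mem_neg (DI.mem_mul hκ (DI.mem_mul hu2 hs2))
  rw [e2] at hp1
  have hpoly := poly4_bound ht.1 ht.2 (DI.abs_le_mag hp0) (coeff_bound hp1 1 e)
    (coeff_bound hp2 2 e) (coeff_bound hp3 3 e) (coeff_bound hp4 4 e)
  have hδ := DI.le_hi_div_of_mem hGI.δ
  unfold defectA
  push_cast [add_div]
  refine le_trans (add_le_add (le_trans (le_of_eq ?_) hpoly) hδ) (le_of_eq ?_)
  · congr 1; ring
  · ring

/-- Soundness of `defectB`. [folklore] -/
theorem defectB_sound (hGI : GI.Mem P G) (dc s1 s2 u1 u2 : ℤ) (e : ℕ) {t : ℝ}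
    (ht : t ∈ Icc 0 ((1 : ℝ) / 2 ^ e)) :
    |G.κ * ((dc : ℝ) / 2 ^ P + (s1 : ℝ) / 2 ^ P * t + (s2 : ℝ) / 2 ^ P * t ^ 2) ^ 2 -
        ((u1 : ℝ) / 2 ^ P + 2 * ((u2 : ℝ) / 2 ^ P) * t)| + G.δ ≤
      ((defectB P GI e dc s1 s2 u1 u2 : ℤ) : ℝ) / 2 ^ P := by
  have hdc := DI.mem_pt P dc
  have hs1 := DI.mem_pt P s1
  have hs2 := DI.mem_pt P s2
  have hu1 := DI.mem_pt P u1
  have hu2 := DI.mem_pt P u2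
  have hκ := hGI.κ
  have e2 : ((2 : ℕ) : ℝ) = 2 := by norm_num
  have hq0 := DI.mem_sub (DI.mem_mul hκ (DI.mem_sq hdc)) hu1
  have hq1 := DI.mem_sub (DI.mem_smul 2 (DI.mem_mul hκ (DI.mem_mul hdc hs1))) (DI.mem_smul 2 hu2)
  have hq2 := DI.mem_mul hκ (DI.mem_add (DI.mem_sq hs1) (DI.mem_smul 2 (DI.mem_mul hdc hs2)))
  have hq3 := DI.mem_smul 2 (DI.mem_mul hκ (DI.mem_mul hs1 hs2))
  have hq4 := DI.mem_mul hκ (DI.mem_sq hs2)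
  rw [e2] at hq1 hq2 hq3
  have hpoly := poly4_bound ht.1 ht.2 (DI.abs_le_mag hq0) (coeff_bound hq1 1 e)
    (coeff_bound hq2 2 e) (coeff_bound hq3 3 e) (coeff_bound hq4 4 e)
  have hδ := DI.le_hi_div_of_mem hGI.δ
  unfold defectB
  push_cast [add_div]
  refine le_trans (add_le_add (le_trans (le_of_eq ?_) hpoly) hδ) (le_of_eq ?_)
  · congr 1; ring
  · ring

end StepSound

/-! ### Soundness, part 3: a checked step is a valid tube step -/

/-- The real step data encoded by a step record (the forcing folded into the brackets).
[folklore] -/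
noncomputable def StepOut.toStep (P : ℕ) (GI : GateDataI) (e : ℕ) (o : StepOut) : TubeStep where
  h := 1 / 2 ^ e
  Al := o.Al / 2 ^ P
  Ah := o.Ah / 2 ^ P
  Bl := o.Bl / 2 ^ P
  Bh := o.Bh / 2 ^ P
  Cl := o.Cl / 2 ^ P
  Ch := o.Ch / 2 ^ P
  Dl := o.Dl / 2 ^ P
  Dh := o.Dh / 2 ^ P
  Zl := o.Zl / 2 ^ P
  Zh := o.Zh / 2 ^ P
  rd := o.rd / 2 ^ P
  rb := o.rb / 2 ^ P
  s1 := ((o.m1 * 2 ^ e : ℤ) : ℝ) / 2 ^ P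
  s2 := ((o.m2 * 2 ^ (2 * e) : ℤ) : ℝ) / 2 ^ P
  u1 := ((o.n1 * 2 ^ e : ℤ) : ℝ) / 2 ^ P
  u2 := ((o.n2 * 2 ^ (2 * e) : ℤ) : ℝ) / 2 ^ P
  Fal := ((o.Fa.lo - GI.δ.hi : ℤ) : ℝ) / 2 ^ P
  Fah := ((o.Fa.hi + GI.δ.hi : ℤ) : ℝ) / 2 ^ P
  Fbl := ((o.Fb.lo - GI.δ.hi : ℤ) : ℝ) / 2 ^ P
  Fbh := ((o.Fb.hi + GI.δ.hi : ℤ) : ℝ) / 2 ^ P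
  Fcl := ((o.Fc.lo - GI.δ.hi : ℤ) : ℝ) / 2 ^ P
  Fch := ((o.Fc.hi + GI.δ.hi : ℤ) : ℝ) / 2 ^ P
  A := o.A / 2 ^ P
  Bz := o.Bz / 2 ^ P
  Kp := o.Kp / 2 ^ P
  la := o.ka / 2 ^ P
  lb := 0
  lc := o.kc / 2 ^ P
  Eal := ((o.Ga.lo - GI.δ.hi : ℤ) : ℝ) / 2 ^ P
  Eah := ((o.Ga.hi + GI.δ.hi : ℤ) : ℝ) / 2 ^ P
  Ebl := ((o.Gb.lo - GI.δ.hi : ℤ) : ℝ) / 2 ^ P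
  Ebh := ((o.Gb.hi + GI.δ.hi : ℤ) : ℝ) / 2 ^ P
  Ecl := ((o.Gc.lo - GI.δ.hi : ℤ) : ℝ) / 2 ^ P
  Ech := ((o.Gc.hi + GI.δ.hi : ℤ) : ℝ) / 2 ^ P

section PostValid

variable {P n : ℕ} {GI : GateDataI} {G : GateData}

/-- Casting helper. [folklore] -/
private theorem cle {P : ℕ} {a b : ℤ} (h : a ≤ b) : (a : ℝ) / 2 ^ P ≤ (b : ℝ) / 2 ^ P :=
  div_le_div_of_nonneg_right (Int.cast_le.2 h) (pow_pos two_pos P).le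

/-- [folklore] -/
private theorem clt {P : ℕ} {a b : ℤ} (h : a < b) : (a : ℝ) / 2 ^ P < (b : ℝ) / 2 ^ P :=
  div_lt_div_of_pos_right (Int.cast_lt.2 h) (pow_pos two_pos P)

/-- [folklore] -/
private theorem sq_scaled {P : ℕ} {V r : ℤ} (h : V * 2 ^ P < r * r) :
    (V : ℝ) / 2 ^ P < ((r : ℝ) / 2 ^ P) ^ 2 := by
  have h2P : (0 : ℝ) < 2 ^ P := pow_pos two_pos P
  have h' : (V : ℝ) * 2 ^ P < (r : ℝ) ^ 2 := by rw [pow_two]; exact_mod_cast h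
  rw [div_pow, lt_div_iff₀ (by positivity)]
  have : (V : ℝ) / 2 ^ P * (2 ^ P) ^ 2 = V * 2 ^ P := by field_simp
  rw [this]; exact h'

/-- [folklore] -/
private theorem sq_scaled_le {P : ℕ} {r s : ℤ} (h : r * r ≤ 2 * (s * s)) :
    ((r : ℝ) / 2 ^ P) ^ 2 ≤ 2 * ((s : ℝ) / 2 ^ P) ^ 2 := by
  have h' : (r : ℝ) ^ 2 ≤ 2 * (s : ℝ) ^ 2 := by rw [pow_two, pow_two]; exact_mod_cast h
  rw [div_pow, div_pow]
  calc (r : ℝ) ^ 2 / (2 ^ P) ^ 2 ≤ 2 * (s : ℝ) ^ 2 / (2 ^ P) ^ 2 :=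
        div_le_div_of_nonneg_right h' (by positivity)
    _ = 2 * ((s : ℝ) ^ 2 / (2 ^ P) ^ 2) := by ring

/-- Box membership gives interval memberships. [folklore] -/
private theorem mems_of_box {P : ℕ} {GI : GateDataI} {e : ℕ} {o : StepOut} {X : Fin 5 → ℝ}
    (hX : (o.toStep P GI e).box X) :
    (⟨o.Al, o.Ah⟩ : DI).mem P (X 0) ∧ (⟨o.Bl, o.Bh⟩ : DI).mem P (X 1) ∧
      (⟨o.Cl, o.Ch⟩ : DI).mem P (X 2) ∧ (⟨o.Dl, o.Dh⟩ : DI).mem P (X 3) := by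
  obtain ⟨⟨h0, h0'⟩, ⟨h1, h1'⟩, ⟨h2, h2'⟩, ⟨h3, h3'⟩⟩ := hX
  exact ⟨DI.mem_mk h0 h0', DI.mem_mk h1 h1', DI.mem_mk h2 h2', DI.mem_mk h3 h3'⟩

/-- **Soundness of the step check.** [folklore] -/
theorem post_valid (hn : 0 < n) (hGI : GI.Mem P G) (hG : G.Valid) (B : TubeBoxD) (e : ℕ)
    (q : Choice) (hok : okB P GI B e (post P n GI B e q) = true) :
    ((post P n GI B e q).toStep P GI e).Valid G (B.toR P) ((post P n GI B e q).B'.toR P) := by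
  have h2P : (0 : ℝ) < 2 ^ P := pow_pos two_pos P
  obtain ⟨he, hrd, hrb, hrr, hA, hBz, hKp, ha0, ha0', hb0, hb0', hc0, hc0', hV0, hEa, hEa', hEb,
    hEb', hEc, hEc', hboot, hka, hkc, hdiv⟩ := of_decide_eq_true hok
  set o := post P n GI B e q with ho
  -- enclosures on the box
  have hbox : ∀ X, (o.toStep P GI e).box X →
      o.Ga.mem P (thresholdCircuit G.ε G.σ G.ν G.μ G.r G.κ X 0 - (o.ka : ℝ) / 2 ^ P * X 0) ∧
      o.Gb.mem P (thresholdCircuit G.ε G.σ G.ν G.μ G.r G.κ X 1) ∧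
      o.Gc.mem P (thresholdCircuit G.ε G.σ G.ν G.μ G.r G.κ X 2 - (o.kc : ℝ) / 2 ^ P * X 2) ∧
      o.Fa.mem P (thresholdCircuit G.ε G.σ G.ν G.μ G.r G.κ X 0) ∧
      o.Fb.mem P (thresholdCircuit G.ε G.σ G.ν G.μ G.r G.κ X 1) ∧
      o.Fc.mem P (thresholdCircuit G.ε G.σ G.ν G.μ G.r G.κ X 2) := by
    intro X hX
    obtain ⟨m0, m1, m2, m3⟩ := mems_of_box hX
    exact brackets_mem hGI _ _ _ _ o.ka o.kc m0 m1 m2 m3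
  -- reference ranges
  have hDl : o.Dl = B.dc + min 0 o.m1 + min 0 o.m2 - o.rd := rfl
  have hDh : o.Dh = B.dc + max 0 o.m1 + max 0 o.m2 + o.rd := rfl
  have hZl : o.Zl = B.zc + min 0 o.n1 + min 0 o.n2 - o.rb := rfl
  have hZh : o.Zh = B.zc + max 0 o.n1 + max 0 o.n2 + o.rb := rfl
  have hZb : (ranges B q.m1 q.m2 q.n1 q.n2 q.rd q.rb).2.2.1 = o.Zl + o.rb := by
    show _ = (ranges B q.m1 q.m2 q.n1 q.n2 q.rd q.rb).2.2.1 - q.rb + q.rb; ring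
  have href : ∀ t ∈ Icc 0 ((1 : ℝ) / 2 ^ e),
      (o.Dl : ℝ) / 2 ^ P + (o.rd : ℝ) / 2 ^ P ≤
          (B.dc : ℝ) / 2 ^ P + ((o.m1 * 2 ^ e : ℤ) : ℝ) / 2 ^ P * t +
            ((o.m2 * 2 ^ (2 * e) : ℤ) : ℝ) / 2 ^ P * t ^ 2 ∧
        (B.dc : ℝ) / 2 ^ P + ((o.m1 * 2 ^ e : ℤ) : ℝ) / 2 ^ P * t +
            ((o.m2 * 2 ^ (2 * e) : ℤ) : ℝ) / 2 ^ P * t ^ 2 + (o.rd : ℝ) / 2 ^ P ≤ (o.Dh : ℝ) / 2 ^ P ∧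
        (o.Zl : ℝ) / 2 ^ P + (o.rb : ℝ) / 2 ^ P ≤
          (B.zc : ℝ) / 2 ^ P + ((o.n1 * 2 ^ e : ℤ) : ℝ) / 2 ^ P * t +
            ((o.n2 * 2 ^ (2 * e) : ℤ) : ℝ) / 2 ^ P * t ^ 2 ∧
        (B.zc : ℝ) / 2 ^ P + ((o.n1 * 2 ^ e : ℤ) : ℝ) / 2 ^ P * t +
            ((o.n2 * 2 ^ (2 * e) : ℤ) : ℝ) / 2 ^ P * t ^ 2 + (o.rb : ℝ) / 2 ^ P ≤ (o.Zh : ℝ) / 2 ^ P := by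
    intro t ht
    have l1 := range_lin (P := P) o.m1 e ht.1 ht.2
    have l2 := range_sq (P := P) o.m2 e ht.1 ht.2
    have l3 := range_lin (P := P) o.n1 e ht.1 ht.2
    have l4 := range_sq (P := P) o.n2 e ht.1 ht.2
    rw [hDl, hDh, hZl, hZh]
    simp only [Int.cast_add, Int.cast_sub, add_div, sub_div] at l1 l2 l3 l4 ⊢
    refine ⟨by linarith, by linarith, by linarith, by linarith⟩
  -- exactness of the centre update
  have hs1h : ((o.m1 * 2 ^ e : ℤ) : ℝ) / 2 ^ P * (1 / 2 ^ e) = (o.m1 : ℝ) / 2 ^ P := by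
    push_cast; field_simp
  have hu1h : ((o.n1 * 2 ^ e : ℤ) : ℝ) / 2 ^ P * (1 / 2 ^ e) = (o.n1 : ℝ) / 2 ^ P := by
    push_cast; field_simp
  have h22 : ((2 : ℝ)) ^ (2 * e) = (2 ^ e) ^ 2 := by rw [mul_comm, pow_mul]
  have hs2h : ((o.m2 * 2 ^ (2 * e) : ℤ) : ℝ) / 2 ^ P * (1 / 2 ^ e) ^ 2 = (o.m2 : ℝ) / 2 ^ P := by
    push_cast; rw [h22]; field_simp
  have hu2h : ((o.n2 * 2 ^ (2 * e) : ℤ) : ℝ) / 2 ^ P * (1 / 2 ^ e) ^ 2 = (o.n2 : ℝ) / 2 ^ P := by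
    push_cast; rw [h22]; field_simp
  have hδ := hGI.δ
  have e2 : ((2 : ℕ) : ℝ) = 2 := by norm_num
  -- the growth constant
  have hKp' : TubeStep.phiBound G.κ ((o.Zl : ℝ) / 2 ^ P + (o.rb : ℝ) / 2 ^ P) ((o.A : ℝ) / 2 ^ P)
      ((o.rd : ℝ) / 2 ^ P) + 2 * ((o.rb : ℝ) / 2 ^ P) * ((o.Bz : ℝ) / 2 ^ P) +
      2 * G.κ * ((o.rd : ℝ) / 2 ^ P) ^ 2 * ((o.rb : ℝ) / 2 ^ P) ≤ (o.Kp : ℝ) / 2 ^ P := by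
    rw [← hZb] at hdiv
    have h1 := phiD_sound (A := o.A) (rd := o.rd) hGI hG hdiv
    have h2 := DI.le_hi_div_of_mem (DI.mem_smul 2 (DI.mem_mul (DI.mem_pt P o.rb) (DI.mem_pt P o.Bz)))
    have h3 := DI.le_hi_div_of_mem (DI.mem_smul 2 (DI.mem_mul (DI.mem_mul hGI.κ
      (DI.mem_sq (DI.mem_pt P o.rd))) (DI.mem_pt P o.rb)))
    rw [e2] at h2 h3
    have hZr : (o.Zl : ℝ) / 2 ^ P + (o.rb : ℝ) / 2 ^ P =
        (((ranges B q.m1 q.m2 q.n1 q.n2 q.rd q.rb).2.2.1 : ℤ) : ℝ) / 2 ^ P := by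
      rw [hZb]; push_cast; ring
    rw [hZr]
    have hK : (o.Kp : ℝ) / 2 ^ P =
        ((phiD P GI (ranges B q.m1 q.m2 q.n1 q.n2 q.rd q.rb).2.2.1 o.A o.rd : ℤ) : ℝ) / 2 ^ P +
        ((((DI.pt o.rb).mul P (DI.pt o.Bz)).smul 2).hi : ℝ) / 2 ^ P +
        ((((GI.κ.mul P ((DI.pt o.rd).sq P)).mul P (DI.pt o.rb)).smul 2).hi : ℝ) / 2 ^ P := by
      rw [← add_div, ← add_div]; congr 1; norm_cast
    rw [hK]
    linarith
  -- the exit `V`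
  have hBV : o.B'.V = B.V + cdiv o.Kp (2 ^ e) := rfl
  have hVle : (B.V : ℝ) / 2 ^ P + 1 / 2 ^ e * ((o.Kp : ℝ) / 2 ^ P) ≤ (o.B'.V : ℝ) / 2 ^ P := by
    rw [hBV, Int.cast_add, add_div]
    have := le_ceil_step (P := P) o.Kp e
    linarith
  refine
    { h_nonneg := by show (0 : ℝ) ≤ 1 / 2 ^ e; positivity
      rd_nonneg := by show (0 : ℝ) ≤ (o.rd : ℝ) / 2 ^ P; simpa using cle (P := P) hrd
      rb_nonneg := by show (0 : ℝ) ≤ (o.rb : ℝ) / 2 ^ P; simpa using cle (P := P) hrb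
      rb_sq_le := sq_scaled_le hrr
      A_nonneg := by show (0 : ℝ) ≤ (o.A : ℝ) / 2 ^ P; simpa using cle (P := P) hA
      Bz_nonneg := by show (0 : ℝ) ≤ (o.Bz : ℝ) / 2 ^ P; simpa using cle (P := P) hBz
      Kp_nonneg := by show (0 : ℝ) ≤ (o.Kp : ℝ) / 2 ^ P; simpa using cle (P := P) hKp
      a0 := ⟨clt ha0, clt ha0'⟩
      b0 := ⟨clt hb0, clt hb0'⟩
      c0 := ⟨clt hc0, clt hc0'⟩
      V0 := sq_scaled hV0
      ref := href
      Fa := fun X hX => ⟨lo_forced (hbox X hX).2.2.2.1 hδ, hi_forced (hbox X hX).2.2.2.1 hδ⟩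
      Fb := fun X hX => ⟨lo_forced (hbox X hX).2.2.2.2.1 hδ, hi_forced (hbox X hX).2.2.2.2.1 hδ⟩
      Fc := fun X hX => ⟨lo_forced (hbox X hX).2.2.2.2.2 hδ, hi_forced (hbox X hX).2.2.2.2.2 hδ⟩
      Ea := by
        refine ⟨(clt hEa).trans_le ?_, lt_of_le_of_lt ?_ (clt hEa')⟩
        · show _ ≤ (B.al : ℝ) / 2 ^ P + 1 / 2 ^ e * (((o.Fa.lo - GI.δ.hi : ℤ) : ℝ) / 2 ^ P)
          have := floor_step_le (P := P) (o.Fa.lo - GI.δ.hi) e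
          push_cast [add_div, sub_div] at this ⊢; linarith
        · show (B.ah : ℝ) / 2 ^ P + 1 / 2 ^ e * (((o.Fa.hi + GI.δ.hi : ℤ) : ℝ) / 2 ^ P) ≤ _
          have := le_ceil_step (P := P) (o.Fa.hi + GI.δ.hi) e
          push_cast [add_div, sub_div] at this ⊢; linarith
      Eb := by
        refine ⟨(clt hEb).trans_le ?_, lt_of_le_of_lt ?_ (clt hEb')⟩
        · show _ ≤ (B.bl : ℝ) / 2 ^ P + 1 / 2 ^ e * (((o.Fb.lo - GI.δ.hi : ℤ) : ℝ) / 2 ^ P)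
          have := floor_step_le (P := P) (o.Fb.lo - GI.δ.hi) e
          push_cast [add_div, sub_div] at this ⊢; linarith
        · show (B.bh : ℝ) / 2 ^ P + 1 / 2 ^ e * (((o.Fb.hi + GI.δ.hi : ℤ) : ℝ) / 2 ^ P) ≤ _
          have := le_ceil_step (P := P) (o.Fb.hi + GI.δ.hi) e
          push_cast [add_div, sub_div] at this ⊢; linarith
      Ec := by
        refine ⟨(clt hEc).trans_le ?_, lt_of_le_of_lt ?_ (clt hEc')⟩
        · show _ ≤ (B.cl : ℝ) / 2 ^ P + 1 / 2 ^ e * (((o.Fc.lo - GI.δ.hi : ℤ) : ℝ) / 2 ^ P)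
          have := floor_step_le (P := P) (o.Fc.lo - GI.δ.hi) e
          push_cast [add_div, sub_div] at this ⊢; linarith
        · show (B.ch : ℝ) / 2 ^ P + 1 / 2 ^ e * (((o.Fc.hi + GI.δ.hi : ℤ) : ℝ) / 2 ^ P) ≤ _
          have := le_ceil_step (P := P) (o.Fc.hi + GI.δ.hi) e
          push_cast [add_div, sub_div] at this ⊢; linarith
      dA := fun t ht X hX => by
        obtain ⟨m0, -, m2, -⟩ := mems_of_box hX
        exact defectA_sound hGI m0 m2 B.zc B.dc _ _ _ _ e ht
      dB := fun t ht => defectB_sound hGI B.dc _ _ _ _ e ht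
      Kp := hKp'
      boot := lt_of_le_of_lt hVle (sq_scaled hboot)
      Ga := fun X hX => ⟨lo_forced (hbox X hX).1 hδ, hi_forced (hbox X hX).1 hδ⟩
      Gb := fun X hX => by
        have h := (hbox X hX).2.1
        refine ⟨?_, ?_⟩
        · show _ ≤ _ - 0 * X 1
          rw [zero_mul, sub_zero]; exact lo_forced h hδ
        · show _ - 0 * X 1 ≤ _
          rw [zero_mul, sub_zero]; exact hi_forced h hδ
      Gc := fun X hX => ⟨lo_forced (hbox X hX).2.2.1 hδ, hi_forced (hbox X hX).2.2.1 hδ⟩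
      a1 := by
        refine ⟨?_, DI.gronwallStep_sound hn (DI.mem_pt P (o.Ga.hi + GI.δ.hi)) hka he⟩
        have hE : (DI.pt (-(o.Ga.lo - GI.δ.hi))).mem P
            (-(((o.Ga.lo - GI.δ.hi : ℤ) : ℝ) / 2 ^ P)) := by
          have := DI.mem_pt P (-(o.Ga.lo - GI.δ.hi)); rwa [Int.cast_neg, neg_div] at this
        exact DI.gronwallStep_sound_lo hn hE hka he
      b1 := by
        refine ⟨?_, ?_⟩
        · have hE : (DI.pt (-(o.Gb.lo - GI.δ.hi))).mem P
              (-(((o.Gb.lo - GI.δ.hi : ℤ) : ℝ) / 2 ^ P)) := by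
            have := DI.mem_pt P (-(o.Gb.lo - GI.δ.hi)); rwa [Int.cast_neg, neg_div] at this
          have := DI.gronwallStep_sound_lo hn (x0 := B.bl) hE (le_refl (0 : ℤ)) he
          rw [Int.cast_zero, zero_div] at this; exact this
        · have := DI.gronwallStep_sound hn (x0 := B.bh) (DI.mem_pt P (o.Gb.hi + GI.δ.hi))
            (le_refl (0 : ℤ)) he
          rw [Int.cast_zero, zero_div] at this; exact this
      c1 := by
        refine ⟨?_, DI.gronwallStep_sound hn (DI.mem_pt P (o.Gc.hi + GI.δ.hi)) hkc he⟩
        have hE : (DI.pt (-(o.Gc.lo - GI.δ.hi))).mem P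
            (-(((o.Gc.lo - GI.δ.hi : ℤ) : ℝ) / 2 ^ P)) := by
          have := DI.mem_pt P (-(o.Gc.lo - GI.δ.hi)); rwa [Int.cast_neg, neg_div] at this
        exact DI.gronwallStep_sound_lo hn hE hkc he
      dc1 := by
        show ((B.dc + o.m1 + o.m2 : ℤ) : ℝ) / 2 ^ P = (B.dc : ℝ) / 2 ^ P +
          ((o.m1 * 2 ^ e : ℤ) : ℝ) / 2 ^ P * (1 / 2 ^ e) +
          ((o.m2 * 2 ^ (2 * e) : ℤ) : ℝ) / 2 ^ P * (1 / 2 ^ e) ^ 2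
        rw [hs1h, hs2h, Int.cast_add, Int.cast_add, add_div, add_div]
      zc1 := by
        show ((B.zc + o.n1 + o.n2 : ℤ) : ℝ) / 2 ^ P = (B.zc : ℝ) / 2 ^ P +
          ((o.n1 * 2 ^ e : ℤ) : ℝ) / 2 ^ P * (1 / 2 ^ e) +
          ((o.n2 * 2 ^ (2 * e) : ℤ) : ℝ) / 2 ^ P * (1 / 2 ^ e) ^ 2
        rw [hu1h, hu2h, Int.cast_add, Int.cast_add, add_div, add_div]
      V1 := hVle }

end PostValid

/-! ### Soundness, part 4: the run -/

namespace HullD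

/-- [folklore] -/
theorem sub_refl (H : HullD) : H.sub H := ⟨le_rfl, le_rfl, le_rfl, le_rfl, le_rfl, le_rfl, le_rfl, le_rfl⟩

/-- [folklore] -/
theorem sub_trans {H K L : HullD} (h₁ : H.sub K) (h₂ : K.sub L) : H.sub L :=
  ⟨h₂.1.trans h₁.1, h₁.2.1.trans h₂.2.1, h₂.2.2.1.trans h₁.2.2.1, h₁.2.2.2.1.trans h₂.2.2.2.1,
    h₂.2.2.2.2.1.trans h₁.2.2.2.2.1, h₁.2.2.2.2.2.1.trans h₂.2.2.2.2.2.1,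
    h₂.2.2.2.2.2.2.1.trans h₁.2.2.2.2.2.2.1, h₁.2.2.2.2.2.2.2.trans h₂.2.2.2.2.2.2.2⟩

/-- [folklore] -/
theorem sub_hull_left (H K : HullD) : H.sub (H.hull K) :=
  ⟨min_le_left _ _, le_max_left _ _, min_le_left _ _, le_max_left _ _, min_le_left _ _,
    le_max_left _ _, min_le_left _ _, le_max_left _ _⟩

/-- [folklore] -/
theorem sub_hull_right (H K : HullD) : K.sub (H.hull K) :=
  ⟨min_le_right _ _, le_max_right _ _, min_le_right _ _, le_max_right _ _, min_le_right _ _,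
    le_max_right _ _, min_le_right _ _, le_max_right _ _⟩

/-- [folklore] -/
theorem memR_mono {P : ℕ} {H K : HullD} (h : H.sub K) {X : Fin 5 → ℝ} (hX : H.memR P X) :
    K.memR P X := by
  have c : ∀ {a b : ℤ}, a ≤ b → (a : ℝ) / 2 ^ P ≤ (b : ℝ) / 2 ^ P := fun h =>
    div_le_div_of_nonneg_right (Int.cast_le.2 h) (pow_pos two_pos P).le
  obtain ⟨h1, h2, h3, h4, h5, h6, h7, h8⟩ := h
  obtain ⟨⟨g1, g2⟩, ⟨g3, g4⟩, ⟨g5, g6⟩, ⟨g7, g8⟩⟩ := hX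
  exact ⟨⟨(c h1).trans g1, g2.trans (c h2)⟩, ⟨(c h3).trans g3, g4.trans (c h4)⟩,
    ⟨(c h5).trans g5, g6.trans (c h6)⟩, ⟨(c h7).trans g7, g8.trans (c h8)⟩⟩

end HullD

section RunSound

variable {P n : ℕ} {GI : GateDataI} {G : GateData}

/-- [folklore] -/
theorem tryEllipse_eq_some {B : TubeBoxD} {e : ℕ} : ∀ {k : ℕ} {rb : ℤ} {o : StepOut},
    tryEllipse P n GI B e k rb = some o →
      ∃ rb' : ℤ, o = compute P n GI B e rb' ∧ okB P GI B e o = true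
  | 0, _, _, h => by simp [tryEllipse] at h
  | k + 1, rb, o, h => by
    simp only [tryEllipse] at h
    split_ifs at h with hok
    · cases h; exact ⟨rb, rfl, hok⟩
    · exact tryEllipse_eq_some h

/-- [folklore] -/
theorem tubeStep_eq_some {B : TubeBoxD} {e : ℕ} {o : StepOut} (h : tubeStep P n GI B e = some o) :
    ∃ q : Choice, o = post P n GI B e q ∧ okB P GI B e o = true := by
  obtain ⟨rb', h1, h2⟩ := tryEllipse_eq_some h
  exact ⟨_, h1, h2⟩

/-- **A checked step transports a forced window**: the exit cross-section contains the window's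
end, and the whole window lies in the step's a-priori box. [folklore] -/
theorem tubeStep_window (hn : 0 < n) (hGI : GI.Mem P G) (hG : G.Valid) {B : TubeBoxD} {e : ℕ}
    {o : StepOut} (h : tubeStep P n GI B e = some o) {y : ℝ → Fin 5 → ℝ}
    (hW : IsForcedWindow G.ε G.σ G.ν G.μ G.r G.κ G.δ (1 / 2 ^ e) y) (h0 : (B.toR P).mem (y 0)) :
    (o.B'.toR P).mem (y (1 / 2 ^ e)) ∧
      ∀ t ∈ Icc 0 ((1 : ℝ) / 2 ^ e), o.box5.memR P (y t) ∧
        (o.Cl : ℝ) / 2 ^ P ≤ y t 2 ∧ y t 2 ≤ (o.Ch : ℝ) / 2 ^ P := by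
  obtain ⟨q, rfl, hok⟩ := tubeStep_eq_some h
  have hV := post_valid hn hGI hG B e q hok
  obtain ⟨hreg, hend⟩ := TubeStep.tube_step hG hV hW h0
  refine ⟨hend, fun t ht => ?_⟩
  obtain ⟨⟨⟨h0l, h0h⟩, ⟨h1l, h1h⟩, ⟨h2l, h2h⟩, ⟨h3l, h3h⟩⟩, -, -, hzl, hzh⟩ :=
    TubeStep.box_of_region hV ht (hreg t ht)
  exact ⟨⟨⟨h0l, h0h⟩, ⟨h1l, h1h⟩, ⟨h3l, h3h⟩, ⟨hzl, hzh⟩⟩, h2l, h2h⟩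

/-- Cube bound from the a-priori data. [folklore] -/
theorem abs_le_of_inBall {R : ℤ} {o : StepOut} (hR : o.inBall R) {X : Fin 5 → ℝ}
    (hX : o.box5.memR P X) (hc : (o.Cl : ℝ) / 2 ^ P ≤ X 2 ∧ X 2 ≤ (o.Ch : ℝ) / 2 ^ P) :
    ∀ i, |X i| ≤ (R : ℝ) / 2 ^ P := by
  have c : ∀ {a b : ℤ}, a ≤ b → (a : ℝ) / 2 ^ P ≤ (b : ℝ) / 2 ^ P := fun h =>
    div_le_div_of_nonneg_right (Int.cast_le.2 h) (pow_pos two_pos P).le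
  obtain ⟨r1, r2, r3, r4, r5, r6, r7, r8, r9, r10⟩ := hR
  obtain ⟨⟨g1, g2⟩, ⟨g3, g4⟩, ⟨g5, g6⟩, ⟨g7, g8⟩⟩ := hX
  have hneg : ((-R : ℤ) : ℝ) / 2 ^ P = -((R : ℝ) / 2 ^ P) := by push_cast; ring
  have l1 := c r1; have l2 := c r2; have l3 := c r3; have l4 := c r4; have l5 := c r5
  have l6 := c r6; have l7 := c r7; have l8 := c r8; have l9 := c r9; have l10 := c r10
  rw [hneg] at l1 l3 l5 l7 l9
  simp only [StepOut.box5] at g1 g2 g3 g4 g5 g6 g7 g8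
  intro i
  fin_cases i
  · show |X 0| ≤ _; exact abs_le.2 ⟨by linarith, by linarith⟩
  · show |X 1| ≤ _; exact abs_le.2 ⟨by linarith, by linarith⟩
  · show |X 2| ≤ _; exact abs_le.2 ⟨by linarith [hc.1], by linarith [hc.2]⟩
  · show |X 3| ≤ _; exact abs_le.2 ⟨by linarith, by linarith⟩
  · show |X 4| ≤ _; exact abs_le.2 ⟨by linarith, by linarith⟩

/-- **Soundness of the run.** For a forced window of the run's duration started in the entry
cross-section: the exit cross-section contains its end; the whole window lies in the cube
`[-R, R]⁵`; and every point of the window (before the end) at trigger level `CL` lies in the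
recorded hull, which by then has been started. [folklore] -/
theorem runTube_sound (hn : 0 < n) (hGI : GI.Mem P G) (hG : G.Valid) (CL R : ℤ) :
    ∀ (sched : List ℕ) (st st' : TubeState), runTube P n GI CL R st sched = some st' →
      ∀ y : ℝ → Fin 5 → ℝ, IsForcedWindow G.ε G.σ G.ν G.μ G.r G.κ G.δ (dur sched) y →
        (st.B.toR P).mem (y 0) →
        (st'.B.toR P).mem (y (dur sched)) ∧
        (st.flag = true → st'.flag = true ∧ st.H.sub st'.H) ∧
        (sched ≠ [] → ∀ t ∈ Icc 0 (dur sched), ∀ i, |y t i| ≤ (R : ℝ) / 2 ^ P) ∧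
        (∀ s ∈ Ico 0 (dur sched), y s 2 = (CL : ℝ) / 2 ^ P →
          st'.flag = true ∧ st'.H.memR P (y s))
  | [], st, st', hrun, y, hW, h0 => by
    simp only [runTube, Option.some.injEq] at hrun
    subst hrun
    have hd0 : dur ([] : List ℕ) = 0 := rfl
    refine ⟨by rw [hd0]; exact h0, fun h => ⟨h, st.H.sub_refl⟩, fun h => absurd rfl h, ?_⟩
    intro s hs; rw [hd0] at hs; exact absurd hs.2 (not_lt.2 hs.1)
  | e :: rest, st, st', hrun, y, hW, h0 => by
    simp only [runTube] at hrun
    cases hst : tubeStep P n GI st.B e with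
    | none => simp [hst] at hrun
    | some o =>
      simp only [hst] at hrun
      split_ifs at hrun with hball
      -- the first step
      have hdur : dur (e :: rest) = 1 / 2 ^ e + dur rest := rfl
      have hh0 : (0 : ℝ) ≤ 1 / 2 ^ e := by positivity
      have hW1 : IsForcedWindow G.ε G.σ G.ν G.μ G.r G.κ G.δ (1 / 2 ^ e) y :=
        hW.mono (by rw [hdur]; linarith [dur_nonneg rest])
      obtain ⟨hend, hstep⟩ := tubeStep_window hn hGI hG hst hW1 h0
      -- the rest, on the shifted window
      have hmem : (1 : ℝ) / 2 ^ e ∈ Icc 0 (dur (e :: rest)) :=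
        ⟨hh0, by rw [hdur]; linarith [dur_nonneg rest]⟩
      have hW2 := hW.shift hmem
      rw [hdur, add_sub_cancel_left] at hW2
      have h0' : ((st.next CL o).B.toR P).mem ((fun s => y (1 / 2 ^ e + s)) 0) := by
        simp only [add_zero]
        have : (st.next CL o).B = o.B' := by unfold TubeState.next; split_ifs <;> rfl
        rw [this]; exact hend
      obtain ⟨ih1, ih2, ih3, ih4⟩ := runTube_sound hn hGI hG CL R rest _ st' hrun _ hW2 h0'
      -- monotonicity through `next`
      have hnext_flag : st.flag = true → (st.next CL o).flag = true := by
        intro hf; unfold TubeState.next; split_ifs <;> simp [hf]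
      have hnext_sub : st.flag = true → st.H.sub (st.next CL o).H := by
        intro hf; unfold TubeState.next; split_ifs
        · simp only; exact HullD.sub_hull_left _ _
        · exact st.H.sub_refl
      refine ⟨?_, ?_, ?_, ?_⟩
      · simpa [hdur] using ih1
      · intro hf
        obtain ⟨f2, s2⟩ := ih2 (hnext_flag hf)
        exact ⟨f2, HullD.sub_trans (hnext_sub hf) s2⟩
      · intro _ t ht i
        by_cases hth : t ≤ 1 / 2 ^ e
        · obtain ⟨hb5, hc1, hc2⟩ := hstep t ⟨ht.1, hth⟩
          exact abs_le_of_inBall hball hb5 ⟨hc1, hc2⟩ i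
        · push Not at hth
          have hne : rest ≠ [] := by
            rintro rfl
            have hd0 : dur ([] : List ℕ) = 0 := rfl
            rw [hdur, hd0] at ht; linarith [ht.2]
          have ht' : t - 1 / 2 ^ e ∈ Icc 0 (dur rest) :=
            ⟨by linarith, by rw [hdur] at ht; linarith [ht.2]⟩
          simpa using ih3 hne (t - 1 / 2 ^ e) ht' i
      · intro s hs hlev
        by_cases hsh : s ≤ 1 / 2 ^ e
        · -- the crossing is registered on this step
          obtain ⟨hb5, hc1, hc2⟩ := hstep s ⟨hs.1, hsh⟩
          have hCL : CL ≤ o.Ch := by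
            have : (CL : ℝ) / 2 ^ P ≤ (o.Ch : ℝ) / 2 ^ P := hlev ▸ hc2
            have h2P : (0 : ℝ) < 2 ^ P := pow_pos two_pos P
            exact_mod_cast (div_le_div_iff_of_pos_right h2P).1 this
          have hnx : st.next CL o = ⟨o.B', true, if st.flag then st.H.hull o.box5 else o.box5⟩ := by
            unfold TubeState.next; rw [if_pos hCL]
          have hf : (st.next CL o).flag = true := by rw [hnx]
          have hH : o.box5.sub (st.next CL o).H := by
            rw [hnx]; dsimp only; split_ifs
            · exact HullD.sub_hull_right _ _
            · exact o.box5.sub_refl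
          obtain ⟨f2, s2⟩ := ih2 hf
          exact ⟨f2, HullD.memR_mono (HullD.sub_trans hH s2) hb5⟩
        · push Not at hsh
          have hs' : s - 1 / 2 ^ e ∈ Ico 0 (dur rest) :=
            ⟨by linarith, by rw [hdur] at hs; linarith [hs.2]⟩
          have := ih4 (s - 1 / 2 ^ e) hs' (by simpa using hlev)
          simpa using this

/-- **The crossing read-out.** If the run succeeds from a cross-section below trigger level `CL`
and ends in one above it, every forced window of the run's duration started in the entry
cross-section reaches level `CL` at some time, inside the recorded hull; and the whole window
lies in the cube `[-R, R]⁵`. [folklore] -/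
theorem runTube_crossing (hn : 0 < n) (hGI : GI.Mem P G) (hG : G.Valid) {CL R : ℤ}
    {sched : List ℕ} {st st' : TubeState} (hrun : runTube P n GI CL R st sched = some st')
    (hne : sched ≠ []) (hlo : st.B.ch < CL) (hhi : CL < st'.B.cl) {y : ℝ → Fin 5 → ℝ}
    (hW : IsForcedWindow G.ε G.σ G.ν G.μ G.r G.κ G.δ (dur sched) y) (h0 : (st.B.toR P).mem (y 0)) :
    (∀ t ∈ Icc 0 (dur sched), ∀ i, |y t i| ≤ (R : ℝ) / 2 ^ P) ∧
      ∃ s ∈ Ico 0 (dur sched), y s 2 = (CL : ℝ) / 2 ^ P ∧ st'.H.memR P (y s) := by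
  obtain ⟨hend, -, hball, hlev⟩ := runTube_sound hn hGI hG CL R sched st st' hrun y hW h0
  refine ⟨hball hne, ?_⟩
  have h2P : (0 : ℝ) < 2 ^ P := pow_pos two_pos P
  have c : ∀ {a b : ℤ}, a < b → (a : ℝ) / 2 ^ P < (b : ℝ) / 2 ^ P := fun h =>
    div_lt_div_of_pos_right (Int.cast_lt.2 h) h2P
  have hy0 : y 0 2 < (CL : ℝ) / 2 ^ P := lt_of_le_of_lt h0.2.2.1.2 (c hlo)
  have hyT : (CL : ℝ) / 2 ^ P < y (dur sched) 2 := lt_of_lt_of_le (c hhi) hend.2.2.1.1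
  have hcont : ContinuousOn (fun t => y t 2) (Icc 0 (dur sched)) :=
    (continuous_apply 2).comp_continuousOn hW.continuousOn
  obtain ⟨s, hs, hsv⟩ := intermediate_value_Icc (dur_nonneg sched) hcont ⟨hy0.le, hyT.le⟩
  have hsT : s ≠ dur sched := by rintro rfl; exact absurd hsv hyT.ne'
  have hs' : s ∈ Ico 0 (dur sched) := ⟨hs.1, lt_of_le_of_ne hs.2 hsT⟩
  exact ⟨s, hs', hsv, (hlev s hs' hsv).2⟩

end RunSound

end Literature.Analysis.FluidPDE.FluidComputer
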